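import Summits.ABC.IUTFork.Conditional.AbcOfCor312SlackRecut
import Summits.ABC.IUTFork.Conditional.AbcOfCor312SlackSharp
import Summits.ABC.IUTFork.Conditional.AbcOfCor312SlackBudget
import HarnessLib

/-!
# The Σ-VARIANT TOLERANCES, RECUT (rh-lead RULING R14 (3)): the SHARP tolerance `Tol♯` of record (R11) and the BUDGET forms
# («abc with a worse constant», `C_K ↦ C_K + 40K` / `+ 4K`) with all three binders CUT TO THE SZPIRO-BAD LOCUS, `hregBad` VERBATIM (p452637)

PROOF-ONLY sequel (no `def`, no new `Prop`, no instance, no notation; nothing re-typed) of this seat's `Conditional/AbcOfCor312SlackRecut.lean`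
(the core recut: `hullEstimateOf_BIII_of_offRegime`, `ABC_of_cor312Slack_szpiroBad_hregBad`), `Conditional/AbcOfCor312SlackSharp.lean` (p471097:
`display_of_squeezeIII_slack_of_le_sharp`, `five_le_sharpCoeff`; rh-lead R11 «tolerance of record = Tol♯») and `Conditional/AbcOfCor312SlackBudget.lean`
(p470555 / p474212: `display_of_squeezeIII_slack` at `η₀ + K`, `Cor22.exists_partII_of_displayAt`). abc-iut-rh2-q2-cond gen 2. TAKES NO SIDE on
[IUTchIII] Cor. 3.12 or on any author.

WHY. `ABC_of_cor312Slack_sharp_of_hullRegime` (p471097), `ABC_of_cor312Slack_budget` / `ABC_of_cor312Slack_absBudget` (p470555 / p474212) carry the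
BLANKET cone binder `hreg`, KERNEL-REFUTED as typed by `Conditional.not_hreg_v4` (p453135) — composition records, VACUOUS AS TYPED in [CONE] (R14 (1)).
Their arithmetic (`display_of_squeezeIII_slack_of_le_sharp`, the `η_prm ↦ η_prm + K` budget) is hreg-free and is reused BY NAME (R14 (2)). Here each
is re-derived with the three binders cut to the SZPIRO-BAD admissible `(P, l)` — antecedent of abc-iut-c312-d1's `Cor22.forall_cor312Of_of_szpiroBad`
«`(l+5)/4 < d_mod ∨ (6l(l+5−4d_mod)/((l+4)(l−3)))·(log-diff + (1−1/l)·log-cond) + (6l(l+5)/((l+4)(l−3)))·log π < log q^{∤{2,l}}(λ)`» inserted after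
(P6) as in p452637 — and `hregBad` = abc-iut-C-cert-2's `Conditional.abc_of_SH_orNum_K_szpiroBad_hregBad` :`hregBad` VERBATIM. Per admissible point
the proof splits on the CONTENT locus of [IUTchIV] Thm. 1.10's display (abc-iut-C-cert-1's `display_of_not_content`: off it the display at any
`η > 0` is free; `szpiroBad_of_content`: on it the point is Szpiro-bad, so the cut binders apply), so in fact NOTHING is assumed at any admissible
`(P, l)` with `log q^{∤{2,l}}(λ) ≤ 120·d*_mod·l`.

WHAT IS TYPED (`d* = 2^{12}·3^3·5·d_mod`, `c♯(l) = 20·(1 − 12/l²) − 84/9`):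
* **`ABC_of_cor312Slack_sharp_szpiroBad_hregBad`** — [NUMΣ-bad] weakened Corollary with slack `ε(P,l,T)` · [TOL♯-bad] `ε ≤ ((l+1)/4)·c♯(l)·d*·l` ·
  [CONE-bad] `hregBad` ⟹ `ABC` with print's constants;
* `displayAt_of_cor312Slack_budget_szpiroBad_hregBad`, **`ABC_of_cor312Slack_budget_szpiroBad_hregBad`** — budget `K ≥ 0`: [TOL-K-bad]
  `ε ≤ ((l+1)/4)·5·(d*·l + K)` ⟹ the display at `η₀ + K` ⟹ `ABC` (`C_K ↦ C_K + 40K` inside Cor. 2.2 (ii), invisible in `ABC`'s `∀ ε ∃ C`);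
* **`ABC_of_cor312Slack_absBudget_szpiroBad_hregBad`** — [TOL+K-bad] `ε ≤ Tol(P,l) + K` (`C_K ↦ C_K + 4K`).
Binder by binder each theorem is STRONGER-OR-EQUAL than its p471097 / p470555 / p474212 record (`hreg ⟹ hregBad`, premise drop).

HONEST FRAMING: locates / conditionally verifies; nothing here asserts that abc is proved or refuted, or that [IUTchIII] Cor. 3.12 / Thm. 3.11 or
[IUTchIV] Thm. 1.10 holds or fails at any datum, or takes a side on any author (Mochizuki / Scholze–Stix / Joshi / Dupuy–Hilado); `h312εBad` / `hTol…` /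
`hregBad` are ASSUMPTION LABELS, never asserted (`hregBad` is neither proved nor refuted as typed); «`ABC` follows from these hypotheses AS TYPED»,
nothing more; typed ≠ proved; instantiated ≠ endorsed; refuted-as-typed ≠ refuted-in-print. [cite: Mochizuki2012, IUTchIV Thm. 1.10 pp. 22–31 (Step (viii)
pp. 30–31, last paragraph p. 31); Prop. 1.6 p. 16; Cor. 2.2 (ii) pp. 41–48] [cite: Mochizuki2012, IUTchIII Cor. 3.12 p. 174] [claim: Mochizuki2012, status: disputed]
-/

noncomputable section

namespace Summit.ABC.IUTFork.Conditional.Cor312Slack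

open Literature.IUT.LogVolume Literature.IUT.HodgeTheaters Literature.NumberTheory.DiophantineGeometry.GenEll
open Summit.ABC.ABC.Theorems NumberField IsDedekindDomain

/-! ## §1 The SHARP tolerance of record `Tol♯`, recut -/

/-- **`abc` from the weakened Corollary with slack `ε ≤ Tol♯(P,l) = ((l+1)/4)·(20·(1 − 12/l²) − 84/9)·d*_mod·l` — all three binders CUT TO THE
SZPIRO-BAD LOCUS** (recut of p471097's `ABC_of_cor312Slack_sharp_of_hullRegime`): [NUMΣ-bad] · [TOL♯-bad] · [CONE-bad] `hregBad` (p452637 VERBATIM)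
⟹ `ABC` with print's constants — pointwise `ThetaPartIIDisplay.thm110Legendre_of_pointwise`; off the content locus `display_of_not_content`; on it
`szpiroBad_of_content`, a datum by `ThetaPartII.stub_thetaData`, the hull estimate by `hullEstimateOf_BIII_of_offRegime` from `hregBad`, the slack
squeeze `logQAvoid_le_of_cor312Slack`, the display by `display_of_squeezeIII_slack_of_le_sharp`; then `Cor22.exists_partII_of_thm110Legendre`,
`Cor22.fullGaloisImage_holds`, `closes`, `genEllTwo_holds`, `JInvWlog_proof`. CONDITIONAL; nothing is asserted about the hypotheses; no side taken.
[cite: Mochizuki2012, IUTchIV Thm. 1.10 Step (viii) pp. 30–31; Cor. 2.2–2.3 pp. 41–55] [cite: Mochizuki2012, IUTchIII Cor. 3.12 p. 174]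
[claim: Mochizuki2012, status: disputed] -/
theorem ABC_of_cor312Slack_sharp_szpiroBad_hregBad
    (ε : ∀ (P : NFPoint) (l : ℕ), Cor22.ThetaVolumeDatumAt P l → ℝ)
    (h312εBad : ∀ P : NFPoint, P ∈ UP → ∀ l : ℕ, l.Prime → 5 ≤ l →
      Cor22.AdmitsCore P → Cor22.CondP2 P l → Cor22.CondP5 P l → Cor22.CondP6 P l →
      (((l : ℝ) + 5) / 4 < (Cor22.dmod P : ℝ) ∨
        6 * l * (((l : ℝ) + 5) - 4 * Cor22.dmod P) / (((l : ℝ) + 4) * ((l : ℝ) - 3))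
            * (P.logDiff + (1 - 1 / (l : ℝ)) * Cor22.logCondAvoid P {2, l})
          + 6 * l * ((l : ℝ) + 5) / (((l : ℝ) + 4) * ((l : ℝ) - 3)) * Real.log Real.pi < Cor22.logQAvoid P {2, l}) →
      ∀ T : Cor22.ThetaVolumeDatumAt P l, T.negAbsLogQ ≤ T.negLogTheta + ε P l T)
    (hTolSharpBad : ∀ P : NFPoint, P ∈ UP → ∀ l : ℕ, l.Prime → 5 ≤ l →
      Cor22.AdmitsCore P → Cor22.CondP2 P l → Cor22.CondP5 P l → Cor22.CondP6 P l →
      (((l : ℝ) + 5) / 4 < (Cor22.dmod P : ℝ) ∨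
        6 * l * (((l : ℝ) + 5) - 4 * Cor22.dmod P) / (((l : ℝ) + 4) * ((l : ℝ) - 3))
            * (P.logDiff + (1 - 1 / (l : ℝ)) * Cor22.logCondAvoid P {2, l})
          + 6 * l * ((l : ℝ) + 5) / (((l : ℝ) + 4) * ((l : ℝ) - 3)) * Real.log Real.pi < Cor22.logQAvoid P {2, l}) →
      ∀ T : Cor22.ThetaVolumeDatumAt P l,
        ε P l T ≤ ((l : ℝ) + 1) / 4 * ((20 * (1 - 12 / (l : ℝ) ^ 2) - 84 / 9) * ((((2 ^ 12 * 3 ^ 3 * 5 * Cor22.dmod P : ℕ) : ℝ)) * l)))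
    (hregBad : ∀ P : NFPoint, P ∈ UP → ∀ l : ℕ, l.Prime → 5 ≤ l →
      Cor22.AdmitsCore P → Cor22.CondP2 P l → Cor22.CondP5 P l → Cor22.CondP6 P l →
      (((l : ℝ) + 5) / 4 < (Cor22.dmod P : ℝ) ∨
        6 * l * (((l : ℝ) + 5) - 4 * Cor22.dmod P) / (((l : ℝ) + 4) * ((l : ℝ) - 3))
            * (P.logDiff + (1 - 1 / (l : ℝ)) * Cor22.logCondAvoid P {2, l})
          + 6 * l * ((l : ℝ) + 5) / (((l : ℝ) + 4) * ((l : ℝ) - 3)) * Real.log Real.pi < Cor22.logQAvoid P {2, l}) →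
      ∀ T : Cor22.ThetaVolumeDatumAt P l,
        (letI := T.instFieldF; letI := T.instNumberFieldF; letI := T.instAlgebraF; letI := T.instFieldK
         letI := T.instNumberFieldK; letI := T.instAlgebraK; letI := T.instFieldFbar; letI := T.instAlgebraFbar
         letI := T.instAlgebraKFbar; letI := T.instIsElliptic
         ¬ (∀ p ∈ T.I.supportPrimes, ∀ v w : placesOver (fieldOfModuli T.E) p,
            (Summit.ABC.IUTFork.DHData.ofInput T.I).logQloc p v = (Summit.ABC.IUTFork.DHData.ofInput T.I).logQloc p w)) →
        T.HullEstimateOf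
          (((l : ℝ) + 1) / 4 *
            ((1 + 12 * (Cor22.dmod P : ℝ) / l) * (P.logDiff + Cor22.logCondAvoid P {2, l})
              + 2 * Real.log l + 52
              + 20 / 3 * Real.log (((2 ^ 12 * 3 ^ 3 * 5 * Cor22.dmod P : ℕ) : ℝ) * (l : ℝ))
                * (Nat.primeCounting (2 ^ 12 * 3 ^ 3 * 5 * Cor22.dmod P * l) : ℝ))))
    : _root_.ABC := by
  refine Summit.ABC.ABC.Theses.IUTThetaPilot.closes ?_ Summit.ABC.ABC.Theorems.genEllTwo_holds Summit.ABC.ABC.Theorems.JInvWlog_proof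
  unfold Summit.ABC.ABC.Theses.IUTThetaPilot.ThetaPartII
  refine Cor22.exists_partII_of_thm110Legendre
    (ThetaPartIIDisplay.thm110Legendre_of_pointwise fun η hη P hP l hl h5 hne hcore hP2 hP5 h6 => ?_) Cor22.fullGaloisImage_holds
  by_cases hct : 6 * ((1 + 20 * (Cor22.dmod P : ℝ) / l) * (P.logDiff + Cor22.logCondAvoid P {2, l}))
        + 120 * (2 ^ 12 * 3 ^ 3 * 5 * (Cor22.dmod P : ℝ) * l) < Cor22.logQAvoid P {2, l}
  swap
  · exact display_of_not_content hη.1 hct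
  have hbad := szpiroBad_of_content h5 hct
  have hl7 : (7 : ℝ) ≤ l := by exact_mod_cast seven_le_of_prime_of_ne_five hl h5 hne
  obtain ⟨T⟩ := ThetaPartII.stub_thetaData P hP l hl h5 hcore hP2 hP5 h6
  have hgap := logQAvoid_le_of_cor312Slack T hP.1 (h312εBad P hP l hl h5 hcore hP2 hP5 h6 hbad T)
    (hullEstimateOf_BIII_of_offRegime hP hl h5 hcore hP2 hP5 h6 T (hregBad P hP l hl h5 hcore hP2 hP5 h6 hbad T))
  refine display_of_squeezeIII_slack_of_le_sharp hl h5 hne hη le_rfl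
    (le_trans (hTolSharpBad P hP l hl h5 hcore hP2 hP5 h6 hbad T) ?_) hgap
  have hη0 : 0 < η := hη.1
  have hc : (0 : ℝ) ≤ ((l : ℝ) + 1) / 4 := by positivity
  have hcS : (0 : ℝ) ≤ 20 * (1 - 12 / (l : ℝ) ^ 2) - 84 / 9 := le_trans (by norm_num) (five_le_sharpCoeff hl7)
  exact mul_le_mul_of_nonneg_left (mul_le_mul_of_nonneg_left (by linarith) hcS) hc

/-! ## §2 The BUDGETED tolerance («abc with a worse constant»), recut -/

/-- **[IUTchIV] Thm. 1.10's display AT `η₀ + K` from the weakened Corollary with a BUDGETED slack — binders CUT TO THE SZPIRO-BAD LOCUS** (recut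
of p470555's `displayAt_of_cor312Slack_budget`): for `K ≥ 0`, `IsEtaPrm η₀`, [NUMΣ-bad] · [TOL-K-bad] `ε ≤ ((l+1)/4)·5·(d*·l + K)` · [CONE-bad]
`hregBad` ⟹ `Cor22.Display P l (η₀ + K)` at every admissible `(P, l)` — off the content locus `display_of_not_content` (`η₀ + K > 0`), on it the slack
chain with `display_of_squeezeIII_slack` at `η₀ + K` (`Cor22.isEtaPrm_mono`; `K ≤ η₀ + K`); `l ≠ 5` by (P6) (`ThetaPartII.seven_le_of_condP6`).
CONDITIONAL; no side taken. [cite: Mochizuki2012, IUTchIV Thm. 1.10 pp. 22–31; Prop. 1.6 p. 16] [claim: Mochizuki2012, status: disputed] -/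
theorem displayAt_of_cor312Slack_budget_szpiroBad_hregBad {K : ℝ} (hK : 0 ≤ K) {η₀ : ℝ} (hη₀ : IsEtaPrm η₀)
    (ε : ∀ (P : NFPoint) (l : ℕ), Cor22.ThetaVolumeDatumAt P l → ℝ)
    (h312εBad : ∀ P : NFPoint, P ∈ UP → ∀ l : ℕ, l.Prime → 5 ≤ l →
      Cor22.AdmitsCore P → Cor22.CondP2 P l → Cor22.CondP5 P l → Cor22.CondP6 P l →
      (((l : ℝ) + 5) / 4 < (Cor22.dmod P : ℝ) ∨
        6 * l * (((l : ℝ) + 5) - 4 * Cor22.dmod P) / (((l : ℝ) + 4) * ((l : ℝ) - 3))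
            * (P.logDiff + (1 - 1 / (l : ℝ)) * Cor22.logCondAvoid P {2, l})
          + 6 * l * ((l : ℝ) + 5) / (((l : ℝ) + 4) * ((l : ℝ) - 3)) * Real.log Real.pi < Cor22.logQAvoid P {2, l}) →
      ∀ T : Cor22.ThetaVolumeDatumAt P l, T.negAbsLogQ ≤ T.negLogTheta + ε P l T)
    (hTolKBad : ∀ P : NFPoint, P ∈ UP → ∀ l : ℕ, l.Prime → 5 ≤ l →
      Cor22.AdmitsCore P → Cor22.CondP2 P l → Cor22.CondP5 P l → Cor22.CondP6 P l →
      (((l : ℝ) + 5) / 4 < (Cor22.dmod P : ℝ) ∨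
        6 * l * (((l : ℝ) + 5) - 4 * Cor22.dmod P) / (((l : ℝ) + 4) * ((l : ℝ) - 3))
            * (P.logDiff + (1 - 1 / (l : ℝ)) * Cor22.logCondAvoid P {2, l})
          + 6 * l * ((l : ℝ) + 5) / (((l : ℝ) + 4) * ((l : ℝ) - 3)) * Real.log Real.pi < Cor22.logQAvoid P {2, l}) →
      ∀ T : Cor22.ThetaVolumeDatumAt P l,
        ε P l T ≤ ((l : ℝ) + 1) / 4 * (5 * ((((2 ^ 12 * 3 ^ 3 * 5 * Cor22.dmod P : ℕ) : ℝ)) * l + K)))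
    (hregBad : ∀ P : NFPoint, P ∈ UP → ∀ l : ℕ, l.Prime → 5 ≤ l →
      Cor22.AdmitsCore P → Cor22.CondP2 P l → Cor22.CondP5 P l → Cor22.CondP6 P l →
      (((l : ℝ) + 5) / 4 < (Cor22.dmod P : ℝ) ∨
        6 * l * (((l : ℝ) + 5) - 4 * Cor22.dmod P) / (((l : ℝ) + 4) * ((l : ℝ) - 3))
            * (P.logDiff + (1 - 1 / (l : ℝ)) * Cor22.logCondAvoid P {2, l})
          + 6 * l * ((l : ℝ) + 5) / (((l : ℝ) + 4) * ((l : ℝ) - 3)) * Real.log Real.pi < Cor22.logQAvoid P {2, l}) →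
      ∀ T : Cor22.ThetaVolumeDatumAt P l,
        (letI := T.instFieldF; letI := T.instNumberFieldF; letI := T.instAlgebraF; letI := T.instFieldK
         letI := T.instNumberFieldK; letI := T.instAlgebraK; letI := T.instFieldFbar; letI := T.instAlgebraFbar
         letI := T.instAlgebraKFbar; letI := T.instIsElliptic
         ¬ (∀ p ∈ T.I.supportPrimes, ∀ v w : placesOver (fieldOfModuli T.E) p,
            (Summit.ABC.IUTFork.DHData.ofInput T.I).logQloc p v = (Summit.ABC.IUTFork.DHData.ofInput T.I).logQloc p w)) →
        T.HullEstimateOf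
          (((l : ℝ) + 1) / 4 *
            ((1 + 12 * (Cor22.dmod P : ℝ) / l) * (P.logDiff + Cor22.logCondAvoid P {2, l})
              + 2 * Real.log l + 52
              + 20 / 3 * Real.log (((2 ^ 12 * 3 ^ 3 * 5 * Cor22.dmod P : ℕ) : ℝ) * (l : ℝ))
                * (Nat.primeCounting (2 ^ 12 * 3 ^ 3 * 5 * Cor22.dmod P * l) : ℝ)))) :
    ∀ P : NFPoint, P ∈ UP → ∀ l : ℕ, l.Prime → 5 ≤ l →
      Cor22.AdmitsCore P → Cor22.CondP2 P l → Cor22.CondP5 P l → Cor22.CondP6 P l → Cor22.Display P l (η₀ + K) := by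
  intro P hP l hl h5 hcore hP2 hP5 h6
  have hη : IsEtaPrm (η₀ + K) := Cor22.isEtaPrm_mono hη₀ (by linarith)
  by_cases hct : 6 * ((1 + 20 * (Cor22.dmod P : ℝ) / l) * (P.logDiff + Cor22.logCondAvoid P {2, l}))
        + 120 * (2 ^ 12 * 3 ^ 3 * 5 * (Cor22.dmod P : ℝ) * l) < Cor22.logQAvoid P {2, l}
  swap
  · exact display_of_not_content hη.1 hct
  have hbad := szpiroBad_of_content h5 hct
  have h7 : 7 ≤ l := ThetaPartII.seven_le_of_condP6 hP hl h5 h6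
  have hne : l ≠ 5 := by omega
  obtain ⟨T⟩ := ThetaPartII.stub_thetaData P hP l hl h5 hcore hP2 hP5 h6
  have hgap := logQAvoid_le_of_cor312Slack T hP.1 (h312εBad P hP l hl h5 hcore hP2 hP5 h6 hbad T)
    (hullEstimateOf_BIII_of_offRegime hP hl h5 hcore hP2 hP5 h6 T (hregBad P hP l hl h5 hcore hP2 hP5 h6 hbad T))
  refine display_of_squeezeIII_slack hl h5 hne hη (le_trans (hTolKBad P hP l hl h5 hcore hP2 hP5 h6 hbad T) ?_) hgap
  have hη0 : 0 < η₀ := hη₀.1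
  have hc : (0 : ℝ) ≤ ((l : ℝ) + 1) / 4 := by positivity
  exact mul_le_mul_of_nonneg_left (by linarith) hc

/-- **`abc` FROM THE WEAKENED COROLLARY WITH A BUDGETED SLACK — binders CUT TO THE SZPIRO-BAD LOCUS, «abc with a worse constant»** (recut of
p470555's `ABC_of_cor312Slack_budget`): for any budget `K ≥ 0`, [NUMΣ-bad] `−|log(q)| ≤ −|log(Θ)| + ε(P,l,T)` at the genuine data of the Szpiro-bad
admissible `(P, l)` · [TOL-K-bad] `ε(P,l,T) ≤ ((l+1)/4)·5·(d*_mod·l + K)` there · [CONE-bad] `hregBad` (p452637 VERBATIM) ⟹ `ABC` — `η₀` from Prop. 1.6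
(`exists_isEtaPrm`), the display at `η₀ + K`, [IUTchIV] Cor. 2.2 (ii) at that single `η_prm` (`Cor22.exists_partII_of_displayAt`, `C_K ↦ C_K + 40·K`,
`H_II = 2^140`), `Cor22.fullGaloisImage_holds`, `closes`, `genEllTwo_holds`, `JInvWlog_proof`. CONDITIONAL; nothing is asserted about the hypotheses;
no side taken. [cite: Mochizuki2012, IUTchIV Cor. 2.2–2.3 pp. 41–55] [cite: Mochizuki2012, IUTchIII Cor. 3.12 p. 174] [claim: Mochizuki2012, status: disputed] -/
theorem ABC_of_cor312Slack_budget_szpiroBad_hregBad {K : ℝ} (hK : 0 ≤ K)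
    (ε : ∀ (P : NFPoint) (l : ℕ), Cor22.ThetaVolumeDatumAt P l → ℝ)
    (h312εBad : ∀ P : NFPoint, P ∈ UP → ∀ l : ℕ, l.Prime → 5 ≤ l →
      Cor22.AdmitsCore P → Cor22.CondP2 P l → Cor22.CondP5 P l → Cor22.CondP6 P l →
      (((l : ℝ) + 5) / 4 < (Cor22.dmod P : ℝ) ∨
        6 * l * (((l : ℝ) + 5) - 4 * Cor22.dmod P) / (((l : ℝ) + 4) * ((l : ℝ) - 3))
            * (P.logDiff + (1 - 1 / (l : ℝ)) * Cor22.logCondAvoid P {2, l})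
          + 6 * l * ((l : ℝ) + 5) / (((l : ℝ) + 4) * ((l : ℝ) - 3)) * Real.log Real.pi < Cor22.logQAvoid P {2, l}) →
      ∀ T : Cor22.ThetaVolumeDatumAt P l, T.negAbsLogQ ≤ T.negLogTheta + ε P l T)
    (hTolKBad : ∀ P : NFPoint, P ∈ UP → ∀ l : ℕ, l.Prime → 5 ≤ l →
      Cor22.AdmitsCore P → Cor22.CondP2 P l → Cor22.CondP5 P l → Cor22.CondP6 P l →
      (((l : ℝ) + 5) / 4 < (Cor22.dmod P : ℝ) ∨
        6 * l * (((l : ℝ) + 5) - 4 * Cor22.dmod P) / (((l : ℝ) + 4) * ((l : ℝ) - 3))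
            * (P.logDiff + (1 - 1 / (l : ℝ)) * Cor22.logCondAvoid P {2, l})
          + 6 * l * ((l : ℝ) + 5) / (((l : ℝ) + 4) * ((l : ℝ) - 3)) * Real.log Real.pi < Cor22.logQAvoid P {2, l}) →
      ∀ T : Cor22.ThetaVolumeDatumAt P l,
        ε P l T ≤ ((l : ℝ) + 1) / 4 * (5 * ((((2 ^ 12 * 3 ^ 3 * 5 * Cor22.dmod P : ℕ) : ℝ)) * l + K)))
    (hregBad : ∀ P : NFPoint, P ∈ UP → ∀ l : ℕ, l.Prime → 5 ≤ l →
      Cor22.AdmitsCore P → Cor22.CondP2 P l → Cor22.CondP5 P l → Cor22.CondP6 P l →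
      (((l : ℝ) + 5) / 4 < (Cor22.dmod P : ℝ) ∨
        6 * l * (((l : ℝ) + 5) - 4 * Cor22.dmod P) / (((l : ℝ) + 4) * ((l : ℝ) - 3))
            * (P.logDiff + (1 - 1 / (l : ℝ)) * Cor22.logCondAvoid P {2, l})
          + 6 * l * ((l : ℝ) + 5) / (((l : ℝ) + 4) * ((l : ℝ) - 3)) * Real.log Real.pi < Cor22.logQAvoid P {2, l}) →
      ∀ T : Cor22.ThetaVolumeDatumAt P l,
        (letI := T.instFieldF; letI := T.instNumberFieldF; letI := T.instAlgebraF; letI := T.instFieldK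
         letI := T.instNumberFieldK; letI := T.instAlgebraK; letI := T.instFieldFbar; letI := T.instAlgebraFbar
         letI := T.instAlgebraKFbar; letI := T.instIsElliptic
         ¬ (∀ p ∈ T.I.supportPrimes, ∀ v w : placesOver (fieldOfModuli T.E) p,
            (Summit.ABC.IUTFork.DHData.ofInput T.I).logQloc p v = (Summit.ABC.IUTFork.DHData.ofInput T.I).logQloc p w)) →
        T.HullEstimateOf
          (((l : ℝ) + 1) / 4 *
            ((1 + 12 * (Cor22.dmod P : ℝ) / l) * (P.logDiff + Cor22.logCondAvoid P {2, l})
              + 2 * Real.log l + 52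
              + 20 / 3 * Real.log (((2 ^ 12 * 3 ^ 3 * 5 * Cor22.dmod P : ℕ) : ℝ) * (l : ℝ))
                * (Nat.primeCounting (2 ^ 12 * 3 ^ 3 * 5 * Cor22.dmod P * l) : ℝ))))
    : _root_.ABC := by
  obtain ⟨η₀, hη₀⟩ := exists_isEtaPrm
  refine Summit.ABC.ABC.Theses.IUTThetaPilot.closes ?_ Summit.ABC.ABC.Theorems.genEllTwo_holds Summit.ABC.ABC.Theorems.JInvWlog_proof
  unfold Summit.ABC.ABC.Theses.IUTThetaPilot.ThetaPartII
  exact Cor22.exists_partII_of_displayAt (Cor22.isEtaPrm_mono hη₀ (by linarith))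
    (displayAt_of_cor312Slack_budget_szpiroBad_hregBad hK hη₀ ε h312εBad hTolKBad hregBad) Cor22.fullGaloisImage_holds

/-- **The ABSOLUTE budget form, recut** (recut of p474212's `ABC_of_cor312Slack_absBudget`; the sentence of rh-lead's MIN-SLICE (ii)): for `K ≥ 0`,
[NUMΣ-bad] · [TOL+K-bad] `ε(P,l,T) ≤ ((l+1)/4)·5·d*_mod·l + K` at the genuine data of the Szpiro-bad admissible `(P, l)` · [CONE-bad] `hregBad` ⟹ `ABC`;
inside, `K ≤ ((l+1)/4)·5·(K/10)` (`l ≥ 7` by (P6)), so this is the budget form with `K/10`: (C2)'s constant becomes `C_K + 4·K`, `H_unif` unchanged.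
CONDITIONAL; nothing is asserted about the hypotheses; no side taken. [cite: Mochizuki2012, IUTchIV Cor. 2.2 (ii) p. 47] [claim: Mochizuki2012, status: disputed] -/
theorem ABC_of_cor312Slack_absBudget_szpiroBad_hregBad {K : ℝ} (hK : 0 ≤ K)
    (ε : ∀ (P : NFPoint) (l : ℕ), Cor22.ThetaVolumeDatumAt P l → ℝ)
    (h312εBad : ∀ P : NFPoint, P ∈ UP → ∀ l : ℕ, l.Prime → 5 ≤ l →
      Cor22.AdmitsCore P → Cor22.CondP2 P l → Cor22.CondP5 P l → Cor22.CondP6 P l →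
      (((l : ℝ) + 5) / 4 < (Cor22.dmod P : ℝ) ∨
        6 * l * (((l : ℝ) + 5) - 4 * Cor22.dmod P) / (((l : ℝ) + 4) * ((l : ℝ) - 3))
            * (P.logDiff + (1 - 1 / (l : ℝ)) * Cor22.logCondAvoid P {2, l})
          + 6 * l * ((l : ℝ) + 5) / (((l : ℝ) + 4) * ((l : ℝ) - 3)) * Real.log Real.pi < Cor22.logQAvoid P {2, l}) →
      ∀ T : Cor22.ThetaVolumeDatumAt P l, T.negAbsLogQ ≤ T.negLogTheta + ε P l T)
    (hTolKBad : ∀ P : NFPoint, P ∈ UP → ∀ l : ℕ, l.Prime → 5 ≤ l →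
      Cor22.AdmitsCore P → Cor22.CondP2 P l → Cor22.CondP5 P l → Cor22.CondP6 P l →
      (((l : ℝ) + 5) / 4 < (Cor22.dmod P : ℝ) ∨
        6 * l * (((l : ℝ) + 5) - 4 * Cor22.dmod P) / (((l : ℝ) + 4) * ((l : ℝ) - 3))
            * (P.logDiff + (1 - 1 / (l : ℝ)) * Cor22.logCondAvoid P {2, l})
          + 6 * l * ((l : ℝ) + 5) / (((l : ℝ) + 4) * ((l : ℝ) - 3)) * Real.log Real.pi < Cor22.logQAvoid P {2, l}) →
      ∀ T : Cor22.ThetaVolumeDatumAt P l,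
        ε P l T ≤ ((l : ℝ) + 1) / 4 * (5 * ((((2 ^ 12 * 3 ^ 3 * 5 * Cor22.dmod P : ℕ) : ℝ)) * l)) + K)
    (hregBad : ∀ P : NFPoint, P ∈ UP → ∀ l : ℕ, l.Prime → 5 ≤ l →
      Cor22.AdmitsCore P → Cor22.CondP2 P l → Cor22.CondP5 P l → Cor22.CondP6 P l →
      (((l : ℝ) + 5) / 4 < (Cor22.dmod P : ℝ) ∨
        6 * l * (((l : ℝ) + 5) - 4 * Cor22.dmod P) / (((l : ℝ) + 4) * ((l : ℝ) - 3))
            * (P.logDiff + (1 - 1 / (l : ℝ)) * Cor22.logCondAvoid P {2, l})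
          + 6 * l * ((l : ℝ) + 5) / (((l : ℝ) + 4) * ((l : ℝ) - 3)) * Real.log Real.pi < Cor22.logQAvoid P {2, l}) →
      ∀ T : Cor22.ThetaVolumeDatumAt P l,
        (letI := T.instFieldF; letI := T.instNumberFieldF; letI := T.instAlgebraF; letI := T.instFieldK
         letI := T.instNumberFieldK; letI := T.instAlgebraK; letI := T.instFieldFbar; letI := T.instAlgebraFbar
         letI := T.instAlgebraKFbar; letI := T.instIsElliptic
         ¬ (∀ p ∈ T.I.supportPrimes, ∀ v w : placesOver (fieldOfModuli T.E) p,
            (Summit.ABC.IUTFork.DHData.ofInput T.I).logQloc p v = (Summit.ABC.IUTFork.DHData.ofInput T.I).logQloc p w)) →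
        T.HullEstimateOf
          (((l : ℝ) + 1) / 4 *
            ((1 + 12 * (Cor22.dmod P : ℝ) / l) * (P.logDiff + Cor22.logCondAvoid P {2, l})
              + 2 * Real.log l + 52
              + 20 / 3 * Real.log (((2 ^ 12 * 3 ^ 3 * 5 * Cor22.dmod P : ℕ) : ℝ) * (l : ℝ))
                * (Nat.primeCounting (2 ^ 12 * 3 ^ 3 * 5 * Cor22.dmod P * l) : ℝ))))
    : _root_.ABC := by
  refine ABC_of_cor312Slack_budget_szpiroBad_hregBad (K := K / 10) (by positivity) ε h312εBad
    (fun P hP l hl h5 hcore hP2 hP5 h6 hbad T => ?_) hregBad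
  refine le_trans (hTolKBad P hP l hl h5 hcore hP2 hP5 h6 hbad T) ?_
  have hl7 : (7 : ℝ) ≤ l := by exact_mod_cast ThetaPartII.seven_le_of_condP6 hP hl h5 h6
  have e : ((l : ℝ) + 1) / 4 * (5 * ((((2 ^ 12 * 3 ^ 3 * 5 * Cor22.dmod P : ℕ) : ℝ)) * l + K / 10)) =
      ((l : ℝ) + 1) / 4 * (5 * ((((2 ^ 12 * 3 ^ 3 * 5 * Cor22.dmod P : ℕ) : ℝ)) * l)) + ((l : ℝ) + 1) / 8 * K := by ring
  rw [e]
  nlinarith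

/-! ## §3 The SHARP tolerance at the θ-CUT SOCKET (C-lead C-R65 (a) / rh-lead R14′: the content sockets of p460293 / p464272) -/

/-- **`abc` from the weakened Corollary with slack `ε ≤ Tol♯(P,l)`, ALL THREE binders CUT TO THE CONTENT LOCUS of [IUTchIV] Thm. 1.10's display**
(θ-cut twin of `ABC_of_cor312Slack_sharp_szpiroBad_hregBad`; the socket named by C-lead ruling C-R65 (a) for the R-H round-2 recut END, binder `hregC` =
abc-iut-C-cert-1's `ABC_of_cor312C_of_hullRegimeC` / `abc_of_SH_v10K_window_content` (p460293) :`hregC` VERBATIM): [NUMΣ-C] `−|log(q)| ≤ −|log(Θ)| + ε(P,l,T)`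
at the genuine data of the admissible `(P, l)` with `6·(1 + 20·d_mod/l)·(log-diff + log-cond) + 120·d*_mod·l < log q^{∤{2,l}}(λ)` · [TOL♯-C]
`ε(P,l,T) ≤ ((l+1)/4)·(20·(1 − 12/l²) − 84/9)·d*_mod·l` there · [CONE-C] `hregC` ⟹ `ABC` with print's constants; off the content locus
`display_of_not_content`, on it the slack chain with `display_of_squeezeIII_slack_of_le_sharp`. The Szpiro-bad form above is a λ-term over this one
(`szpiroBad_of_content`); `Tol ≤ Tol♯` (`five_le_sharpCoeff`) makes p476943's `ABC_of_cor312Slack_content_hregC` a corollary too. At every admissible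
`(P, l)` with `log q^{∤{2,l}}(λ) ≤ 120·d*_mod·l` NOTHING is assumed. CONDITIONAL; nothing is asserted about the hypotheses; no side taken.
[cite: Mochizuki2012, IUTchIV Thm. 1.10 Step (viii) pp. 30–31; Cor. 2.2–2.3 pp. 41–55] [cite: Mochizuki2012, IUTchIII Cor. 3.12 p. 174]
[claim: Mochizuki2012, status: disputed] -/
theorem ABC_of_cor312Slack_sharp_content_hregC
    (ε : ∀ (P : NFPoint) (l : ℕ), Cor22.ThetaVolumeDatumAt P l → ℝ)
    (h312C : ∀ P : NFPoint, P ∈ UP → ∀ l : ℕ, l.Prime → 5 ≤ l →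
      Cor22.AdmitsCore P → Cor22.CondP2 P l → Cor22.CondP5 P l → Cor22.CondP6 P l →
      6 * ((1 + 20 * (Cor22.dmod P : ℝ) / l) * (P.logDiff + Cor22.logCondAvoid P {2, l}))
          + 120 * (2 ^ 12 * 3 ^ 3 * 5 * (Cor22.dmod P : ℝ) * l) < Cor22.logQAvoid P {2, l} →
      ∀ T : Cor22.ThetaVolumeDatumAt P l, T.negAbsLogQ ≤ T.negLogTheta + ε P l T)
    (hTolSharpC : ∀ P : NFPoint, P ∈ UP → ∀ l : ℕ, l.Prime → 5 ≤ l →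
      Cor22.AdmitsCore P → Cor22.CondP2 P l → Cor22.CondP5 P l → Cor22.CondP6 P l →
      6 * ((1 + 20 * (Cor22.dmod P : ℝ) / l) * (P.logDiff + Cor22.logCondAvoid P {2, l}))
          + 120 * (2 ^ 12 * 3 ^ 3 * 5 * (Cor22.dmod P : ℝ) * l) < Cor22.logQAvoid P {2, l} →
      ∀ T : Cor22.ThetaVolumeDatumAt P l,
        ε P l T ≤ ((l : ℝ) + 1) / 4 * ((20 * (1 - 12 / (l : ℝ) ^ 2) - 84 / 9) * ((((2 ^ 12 * 3 ^ 3 * 5 * Cor22.dmod P : ℕ) : ℝ)) * l)))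
    (hregC : ∀ P : NFPoint, P ∈ UP → ∀ l : ℕ, l.Prime → 5 ≤ l →
      Cor22.AdmitsCore P → Cor22.CondP2 P l → Cor22.CondP5 P l → Cor22.CondP6 P l →
      6 * ((1 + 20 * (Cor22.dmod P : ℝ) / l) * (P.logDiff + Cor22.logCondAvoid P {2, l}))
          + 120 * (2 ^ 12 * 3 ^ 3 * 5 * (Cor22.dmod P : ℝ) * l) < Cor22.logQAvoid P {2, l} →
      ∀ T : Cor22.ThetaVolumeDatumAt P l,
        (letI := T.instFieldF; letI := T.instNumberFieldF; letI := T.instAlgebraF; letI := T.instFieldK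
         letI := T.instNumberFieldK; letI := T.instAlgebraK; letI := T.instFieldFbar; letI := T.instAlgebraFbar
         letI := T.instAlgebraKFbar; letI := T.instIsElliptic
         ¬ (∀ p ∈ T.I.supportPrimes, ∀ v w : placesOver (fieldOfModuli T.E) p,
            (Summit.ABC.IUTFork.DHData.ofInput T.I).logQloc p v = (Summit.ABC.IUTFork.DHData.ofInput T.I).logQloc p w)) →
        T.HullEstimateOf
          (((l : ℝ) + 1) / 4 *
            ((1 + 12 * (Cor22.dmod P : ℝ) / l) * (P.logDiff + Cor22.logCondAvoid P {2, l})
              + 2 * Real.log l + 52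
              + 20 / 3 * Real.log (((2 ^ 12 * 3 ^ 3 * 5 * Cor22.dmod P : ℕ) : ℝ) * (l : ℝ))
                * (Nat.primeCounting (2 ^ 12 * 3 ^ 3 * 5 * Cor22.dmod P * l) : ℝ))))
    : _root_.ABC := by
  refine Summit.ABC.ABC.Theses.IUTThetaPilot.closes ?_ Summit.ABC.ABC.Theorems.genEllTwo_holds Summit.ABC.ABC.Theorems.JInvWlog_proof
  unfold Summit.ABC.ABC.Theses.IUTThetaPilot.ThetaPartII
  refine Cor22.exists_partII_of_thm110Legendre
    (ThetaPartIIDisplay.thm110Legendre_of_pointwise fun η hη P hP l hl h5 hne hcore hP2 hP5 h6 => ?_) Cor22.fullGaloisImage_holds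
  by_cases hct : 6 * ((1 + 20 * (Cor22.dmod P : ℝ) / l) * (P.logDiff + Cor22.logCondAvoid P {2, l}))
        + 120 * (2 ^ 12 * 3 ^ 3 * 5 * (Cor22.dmod P : ℝ) * l) < Cor22.logQAvoid P {2, l}
  swap
  · exact display_of_not_content hη.1 hct
  have hl7 : (7 : ℝ) ≤ l := by exact_mod_cast seven_le_of_prime_of_ne_five hl h5 hne
  obtain ⟨T⟩ := ThetaPartII.stub_thetaData P hP l hl h5 hcore hP2 hP5 h6
  have hgap := logQAvoid_le_of_cor312Slack T hP.1 (h312C P hP l hl h5 hcore hP2 hP5 h6 hct T)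
    (hullEstimateOf_BIII_of_offRegime hP hl h5 hcore hP2 hP5 h6 T (hregC P hP l hl h5 hcore hP2 hP5 h6 hct T))
  refine display_of_squeezeIII_slack_of_le_sharp hl h5 hne hη le_rfl
    (le_trans (hTolSharpC P hP l hl h5 hcore hP2 hP5 h6 hct T) ?_) hgap
  have hη0 : 0 < η := hη.1
  have hc : (0 : ℝ) ≤ ((l : ℝ) + 1) / 4 := by positivity
  have hcS : (0 : ℝ) ≤ 20 * (1 - 12 / (l : ℝ) ^ 2) - 84 / 9 := le_trans (by norm_num) (five_le_sharpCoeff hl7)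
  exact mul_le_mul_of_nonneg_left (mul_le_mul_of_nonneg_left (by linarith) hcS) hc

end Summit.ABC.IUTFork.Conditional.Cor312Slack

end
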